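import Mathlib
import HarnessLib
import Summits.RiemannHypothesis.RiemannHypothesis.Theorems.EarlyAppointmentsNcardFiniteBound
import Summits.RiemannHypothesis.RiemannHypothesis.Theorems.EarlyAppointmentsGBoundComplete

/-!
# Combining one-sided ncard bounds

From two one-sided ncard bounds (left and right of x₀), we derive the total count
and construct a Finset suitable for G_im_bound_from_eps_regular.
-/

open Set Real Complex
open scoped BigOperators

noncomputable section

namespace CombDescentNcardCombine

variable {f : ℂ → ℂ} {x₀ s h ε : ℝ}

/-- Right zeros: {x | f x = 0 ∧ x₀ < x ∧ x ≤ x₀ + h} -/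
def zerosRight (f : ℂ → ℂ) (x₀ h : ℝ) : Set ℝ :=
  {x : ℝ | f (x : ℂ) = 0 ∧ x₀ < x ∧ x ≤ x₀ + h}

/-- Left zeros: {x | f x = 0 ∧ x₀ - h ≤ x ∧ x < x₀} -/
def zerosLeft (f : ℂ → ℂ) (x₀ h : ℝ) : Set ℝ :=
  {x : ℝ | f (x : ℂ) = 0 ∧ x₀ - h ≤ x ∧ x < x₀}

/-- All zeros in (x₀ - h, x₀ + h) \ {x₀} -/
def zerosBoth (f : ℂ → ℂ) (x₀ h : ℝ) : Set ℝ :=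
  zerosRight f x₀ h ∪ zerosLeft f x₀ h

/-- Right and left zeros are disjoint since one has x > x₀ and the other x < x₀. -/
theorem zerosRight_zerosLeft_disjoint : Disjoint (zerosRight f x₀ h) (zerosLeft f x₀ h) := by
  rw [Set.disjoint_iff]
  intro x ⟨hr, hl⟩
  simp only [zerosRight, zerosLeft, mem_setOf_eq] at hr hl
  linarith [hr.2.1, hl.2.2]

/-- Right zeros lie within distance h of x₀. -/
theorem zerosRight_subset_ball (_hh : 0 < h) : zerosRight f x₀ h ⊆ {x : ℝ | |x₀ - x| ≤ h} := by
  intro x hx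
  simp only [zerosRight, mem_setOf_eq] at hx ⊢
  have hx1 : x₀ < x := hx.2.1
  have hx2 : x ≤ x₀ + h := hx.2.2
  rw [abs_of_nonpos (by linarith : x₀ - x ≤ 0)]
  linarith

/-- Left zeros lie within distance h of x₀. -/
theorem zerosLeft_subset_ball (_hh : 0 < h) : zerosLeft f x₀ h ⊆ {x : ℝ | |x₀ - x| ≤ h} := by
  intro x hx
  simp only [zerosLeft, mem_setOf_eq] at hx ⊢
  have hx1 : x₀ - h ≤ x := hx.2.1
  have hx2 : x < x₀ := hx.2.2
  rw [abs_of_nonneg (by linarith : 0 ≤ x₀ - x)]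
  linarith

/-- Combined zeros lie within distance h of x₀. -/
theorem zerosBoth_subset_ball (hh : 0 < h) : zerosBoth f x₀ h ⊆ {x : ℝ | |x₀ - x| ≤ h} := by
  intro x hx
  cases hx with
  | inl hr => exact zerosRight_subset_ball hh hr
  | inr hl => exact zerosLeft_subset_ball hh hl

/-- The union's ncard equals the sum since the sets are disjoint. -/
theorem ncard_zerosBoth_eq (hR_fin : (zerosRight f x₀ h).Finite)
    (hL_fin : (zerosLeft f x₀ h).Finite) :
    (zerosBoth f x₀ h).ncard = (zerosRight f x₀ h).ncard + (zerosLeft f x₀ h).ncard := by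
  exact Set.ncard_union_eq zerosRight_zerosLeft_disjoint hR_fin hL_fin

/-- From two one-sided bounds, derive total count bound.
Each side: |ncard - h/s| ≤ ε*h/s + 1, so ncard ≥ h/s - ε*h/s - 1 = (1-ε)*h/s - 1.
Total: ncard ≥ 2*(1-ε)*h/s - 2 = (1 - (ε + s/h))*2*h/s. -/
theorem total_count_bound (hs : 0 < s) (hh : 0 < h)
    (hR_bound : |(((zerosRight f x₀ h).ncard : ℕ) : ℝ) - h / s| ≤ ε * h / s + 1)
    (hL_bound : |(((zerosLeft f x₀ h).ncard : ℕ) : ℝ) - h / s| ≤ ε * h / s + 1)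
    (hR_fin : (zerosRight f x₀ h).Finite)
    (hL_fin : (zerosLeft f x₀ h).Finite) :
    ((1 - (ε + s / h)) * 2 * h / s : ℝ) ≤ (zerosBoth f x₀ h).ncard := by
  have hR_lb : ((zerosRight f x₀ h).ncard : ℝ) ≥ h / s - (ε * h / s + 1) := by
    have := abs_le.mp hR_bound
    linarith [this.1]
  have hL_lb : ((zerosLeft f x₀ h).ncard : ℝ) ≥ h / s - (ε * h / s + 1) := by
    have := abs_le.mp hL_bound
    linarith [this.1]
  have htot : ((zerosBoth f x₀ h).ncard : ℝ) =
      (zerosRight f x₀ h).ncard + (zerosLeft f x₀ h).ncard := by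
    rw [ncard_zerosBoth_eq hR_fin hL_fin]
    simp only [Nat.cast_add]
  rw [htot]
  have h1 : (zerosRight f x₀ h).ncard + (zerosLeft f x₀ h).ncard ≥
      2 * (h / s - (ε * h / s + 1)) := by linarith
  have h2 : 2 * (h / s - (ε * h / s + 1)) = 2 * h / s - 2 * ε * h / s - 2 := by ring
  have h3 : (1 - (ε + s / h)) * 2 * h / s = 2 * h / s - 2 * ε * h / s - 2 := by
    have hs_ne : s ≠ 0 := ne_of_gt hs
    field_simp
    ring
  linarith [h1, h2, h3]

/-- Finiteness of right zeros from the bound. -/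
theorem zerosRight_finite (_hs : 0 < s) (_hh : 0 < h) (_hε : 0 ≤ ε) (hεh : ε * h / s + 1 < h / s)
    (hR_bound : |(((zerosRight f x₀ h).ncard : ℕ) : ℝ) - h / s| ≤ ε * h / s + 1) :
    (zerosRight f x₀ h).Finite := by
  apply Set.finite_of_ncard_bound (n := h / s) (ε := ε * h / s + 1)
  · linarith
  · exact hR_bound

/-- Finiteness of left zeros from the bound. -/
theorem zerosLeft_finite (_hs : 0 < s) (_hh : 0 < h) (_hε : 0 ≤ ε) (hεh : ε * h / s + 1 < h / s)
    (hL_bound : |(((zerosLeft f x₀ h).ncard : ℕ) : ℝ) - h / s| ≤ ε * h / s + 1) :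
    (zerosLeft f x₀ h).Finite := by
  apply Set.finite_of_ncard_bound (n := h / s) (ε := ε * h / s + 1)
  · linarith
  · exact hL_bound

/-- The condition for finiteness: h/s > ε*h/s + 1, i.e., (1-ε)*h/s > 1. -/
theorem finiteness_condition (hs : 0 < s) (_hh : 0 < h) (hε : ε ≤ 1/8) (hsh : 8 * s ≤ h) :
    ε * h / s + 1 < h / s := by
  -- We have h/s ≥ 8 and ε ≤ 1/8
  -- Want: h/s - ε*h/s > 1, i.e., (1-ε)*h/s > 1
  -- Since 1-ε ≥ 7/8 and h/s ≥ 8, we have (1-ε)*h/s ≥ (7/8)*8 = 7 > 1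
  have hs_ne : s ≠ 0 := ne_of_gt hs
  have hhs : h / s ≥ 8 := by
    rw [ge_iff_le, le_div_iff₀' hs]
    linarith
  have h1 : (1 - ε) ≥ 7/8 := by linarith
  have h2 : (1 - ε) * (h / s) ≥ (7/8) * 8 := by
    calc (1 - ε) * (h / s) ≥ (7/8) * (h / s) := by nlinarith [hhs]
      _ ≥ (7/8) * 8 := by nlinarith
  have h3 : (7/8 : ℝ) * 8 = 7 := by norm_num
  have h4 : (1 - ε) * (h / s) > 1 := by linarith
  have h5 : h / s - ε * (h / s) > 1 := by
    have : (1 - ε) * (h / s) = h / s - ε * (h / s) := by ring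
    linarith
  have h6 : ε * h / s = ε * (h / s) := by ring
  linarith

/-- Main construction: given the hcomb hypotheses, construct a Finset with count bound. -/
theorem construct_finset (hs : 0 < s) (hh : 0 < h) (hε : 0 ≤ ε) (hε_small : ε ≤ 1/8)
    (hsh : 8 * s ≤ h)
    (hR_bound : |(((zerosRight f x₀ h).ncard : ℕ) : ℝ) - h / s| ≤ ε * h / s + 1)
    (hL_bound : |(((zerosLeft f x₀ h).ncard : ℕ) : ℝ) - h / s| ≤ ε * h / s + 1) :
    ∃ S : Finset ℝ,
      (∀ ξ ∈ S, |x₀ - ξ| ≤ h) ∧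
      ((1 - (ε + s / h)) * 2 * h / s : ℝ) ≤ S.card := by
  have hfin_cond := finiteness_condition hs hh hε_small hsh
  have hR_fin := zerosRight_finite hs hh hε hfin_cond hR_bound
  have hL_fin := zerosLeft_finite hs hh hε hfin_cond hL_bound
  have hBoth_fin : (zerosBoth f x₀ h).Finite := Set.Finite.union hR_fin hL_fin
  use hBoth_fin.toFinset
  constructor
  · intro ξ hξ
    rw [Set.Finite.mem_toFinset] at hξ
    exact zerosBoth_subset_ball (by linarith : 0 < h) hξ
  · have hcount := total_count_bound hs hh hR_bound hL_bound hR_fin hL_fin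
    have hcard : (hBoth_fin.toFinset.card : ℝ) = (zerosBoth f x₀ h).ncard := by
      rw [Set.ncard_eq_toFinset_card _ hBoth_fin]
    rw [hcard]
    exact hcount

end CombDescentNcardCombine

end
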